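import Summits.AtomisticToContinuum.Crystallization.Theses.ReggeStarCoercivity
import Summits.AtomisticToContinuum.Crystallization.Theorems.ReggeStarCoercivityDefectFreeCrystallizesFunnelSitesDefs
import Summits.AtomisticToContinuum.Crystallization.Theorems.ReggeStarCoercivityDefectFreeCrystallizesRouteBetaRootDiscount
import Summits.AtomisticToContinuum.Crystallization.Theorems.ReggeStarCoercivityDefectFreeCrystallizesAnnulusCount
import Summits.AtomisticToContinuum.Crystallization.Theorems.PalmUnimodularRigidityLayeredLawsSelectHcpMinimiserEnclosure
import Literature.MathematicalPhysics.StatisticalMechanics.BarlowStackingEnergy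

/-!
# Route `ReggeStarCoercivity`, crux `DefectFreeCrystallizes` (stmt-AtomisticToContinuum-13603), line `palm-good-law` (v36):
# the glue `stub_coreOfGaugedFloor` — the POINTWISE GAUGED DEFECT FLOOR AT THE ROOT (S4″) PRICES INTO THE κ-CORE

**Theorem** (`stub_coreOfGaugedFloor`).  Hypothesis = the registered S4″ `stub_gaugedDefectFloorRoot` (for the relaxed reference `(a₀, h₀)`
and every hard core `δ`: a price `κ > 0`, a root discount `0 ≤ W ≤ J₃ − J₂`, and for every slack `ε > 0` a bounded finite-range measurable
bond transfer `t` with `barlowSiteEnergy lennardJones a₀ h₀ s k − ε − W·[root cubic] + κ·D(μ) ≤ h(μ) + div t(μ)` on EVERY rooted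
`δ`-separated everywhere-`SetGood` Barlow-charted force-balanced `μ = count|S` with root label `(k, i, j)`;
`D(μ) = min (starDefect a₀ h₀ μ) (fcc star defect) + μ{11/10 < ‖y‖ ≤ 5/4}`).  Conclusion = the κ-CORE (hypothesis of the landed
`ExactStarShortcut.defectFreeCrystallizes_of_core`): with the same `κ`, for every measurable version `Dm` of `ofReal ∘ D` on rooted
`δ`-hard-core configurations and every point-stationary probability law `P` a.s. carried by such configurations,
`hcpE a₀ h₀ + κ·(∫⁻ Dm dP).toReal ≤ E_P[h]`.

**Proof** (law-level Mecke pricing; the landed pattern `RouteBetaReshape` + `RouteBetaLawFree`, price `κ·Dm` in place of `κ·1[bad root]`).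
The certified enclosure `LayeredLawsSelectHcp.tube_minimiserEnclosure` puts `(a₀, h₀)` in item 3063's box, so the LJ site-energy column
`SiteColumnLJ.stub_siteColumnLJ` applies AT `(a₀, h₀)`.  Level function
`ℓ(μ) = hcpE a₀ h₀ − ε + (J₃−J₂)/6·#(marked 6/5-neighbours) − (J₃−J₂+W)·[root marked] + κ·(Dm μ).toReal` (mark = the measurable
root-covariant cubic mark `CubicMarkVersion.stub_cubicMarkVersion`); a.s. `ℓ ≤ h + div t` by S4″, `RootCubicCount.stub_rootCubicCount`,
`FunnelSites.isCubicSite65_chart_iff` and the column; `ℓ` is `P`-integrable (twelve neighbours; `Dm ≤ Σ_p (‖a₀ p‖ + 11/10)² + N(δ)` a.s. by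
`AnnulusCount.stub_annulusCount`); `LevelPricing.stub_levelPricing` gives `E_P[ℓ] ≤ E_P[h]`; `CovariantMecke.stub_covariantMecke` gives
`E_P[#marked nbrs] = 12·P(root marked)`, whence `E_P[ℓ] ≥ hcpE a₀ h₀ − ε + κ·(∫⁻ Dm dP).toReal`; `ε ↓ 0`.  All `[folklore]`; no definitions.
-/

noncomputable section

open scoped BigOperators ENNReal
open Filter Topology MeasureTheory

namespace Summit.AtomisticToContinuum.Crystallization.Theorems.PalmGoodLaw.CoreOfGaugedFloor

open Summit.AtomisticToContinuum.Crystallization.Theses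
open Literature.MathematicalPhysics.StatisticalMechanics Literature.Geometry.DiscreteGeometry
open Literature.Probability.Process
open Summit.AtomisticToContinuum.Crystallization.Theorems.PalmGoodLaw (SetGood)
open Summit.AtomisticToContinuum.Crystallization.Theorems.PalmGoodLaw (FunnelSites.IsCubicSite65)
open Summit.AtomisticToContinuum.Crystallization.Theorems.PalmUnimodularRigidity.LayeredLawsSelectHcp
  (rootStar starDefect starDefect_nonneg pts tube_minimiserEnclosure)

/-- The congruence defect of the root star against the regular cuboctahedron of edge `a₀` is at most `Σ_p (‖a₀ • p‖ + 11/10)²`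
(anchor of this file: take `A = 1`; the root star lies in the closed ball of radius `11/10`, and an empty star has defect `0`).
[folklore] -/
theorem iInf_fccDefect_le (a₀ : ℝ) (μ : Measure (EuclideanSpace ℝ (Fin 3))) :
    (⨅ A : EuclideanSpace ℝ (Fin 3) ≃ₗᵢ[ℝ] EuclideanSpace ℝ (Fin 3),
        ∑ p ∈ fccKissingPattern, Metric.infDist (A (a₀ • p)) (rootStar μ) ^ 2) ≤
      ∑ p ∈ fccKissingPattern, (‖a₀ • p‖ + 11 / 10) ^ 2 := by
  have hbdd : BddBelow (Set.range fun A : EuclideanSpace ℝ (Fin 3) ≃ₗᵢ[ℝ] EuclideanSpace ℝ (Fin 3) =>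
      ∑ p ∈ fccKissingPattern, Metric.infDist (A (a₀ • p)) (rootStar μ) ^ 2) :=
    ⟨0, Set.forall_mem_range.2 fun A => Finset.sum_nonneg fun i _ => sq_nonneg _⟩
  refine ciInf_le_of_le hbdd (LinearIsometryEquiv.refl ℝ (EuclideanSpace ℝ (Fin 3)))
    (Finset.sum_le_sum fun p _ => pow_le_pow_left₀ Metric.infDist_nonneg ?_ 2)
  rw [LinearIsometryEquiv.coe_refl, id]
  rcases (rootStar μ).eq_empty_or_nonempty with h | ⟨y, hy⟩
  · rw [h, Metric.infDist_empty]
    positivity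
  · have hy' : μ {y} ≠ 0 ∧ 0 < ‖y‖ ∧ ‖y‖ ≤ 11 / 10 := hy
    exact (Metric.infDist_le_dist_of_mem hy).trans
      ((dist_le_norm_add_norm _ _).trans (add_le_add le_rfl hy'.2.2))

/-- The certified enclosure of the global minimiser of `hcpE` (`LayeredLawsSelectHcp.tube_minimiserEnclosure`:
`|a₀ − 0.97129| ≤ 10⁻⁴`, `|h₀ − 0.79294| ≤ 10⁻⁴`) puts the relaxed reference inside item 3063's box
`47/50 ≤ a₀ ≤ 1`, `39/50·a₀ ≤ h₀ ≤ 17/20·a₀` (where the Lennard-Jones site-energy column lives). [folklore] -/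
theorem box3063_of_isMin (a₀ h₀ : ℝ) (ha₁ : 189 / 200 ≤ a₀) (ha₂ : a₀ ≤ 199 / 200) (hh₁ : 77 / 100 ≤ h₀) (hh₂ : h₀ ≤ 163 / 200)
    (hmin : ∀ a h : ℝ, 0 < a → 0 < h →
      Summit.AtomisticToContinuum.Crystallization.Theorems.PalmUnimodularRigidity.LayeredLawsSelectHcp.hcpE a₀ h₀ ≤
        Summit.AtomisticToContinuum.Crystallization.Theorems.PalmUnimodularRigidity.LayeredLawsSelectHcp.hcpE a h) :
    47 / 50 ≤ a₀ ∧ a₀ ≤ 1 ∧ 39 / 50 * a₀ ≤ h₀ ∧ h₀ ≤ 17 / 20 * a₀ := by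
  obtain ⟨hea, heh⟩ := tube_minimiserEnclosure a₀ h₀ ha₁ ha₂ hh₁ hh₂ hmin
  rw [abs_le] at hea heh
  obtain ⟨ha3, ha4⟩ := hea
  obtain ⟨hh3, hh4⟩ := heh
  exact ⟨by linarith, by linarith, by linarith, by linarith⟩

/-- **`stub_coreOfGaugedFloor` — GLUE of line `palm-good-law` (v36): the pointwise gauged defect floor S4″ prices into the κ-CORE**
(the hypothesis of the landed `ExactStarShortcut.defectFreeCrystallizes_of_core`, verbatim).  Mecke level pricing
(`LevelPricing.stub_levelPricing`) of the `P`-integrable level function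
`ℓ(μ) = hcpE a₀ h₀ − ε + (J₃−J₂)/6·#(marked 6/5-neighbours) − (J₃−J₂+W)·[root marked] + κ·(Dm μ).toReal`; a.s. `ℓ ≤ h + div t` by S4″ at
the SAME `(a₀, h₀)` (`box3063_of_isMin`, `SiteColumnLJ.stub_siteColumnLJ`, `RootCubicCount.stub_rootCubicCount`,
`FunnelSites.isCubicSite65_chart_iff`); `E_P[#marked nbrs] = 12·P(root marked)` (`CovariantMecke.stub_covariantMecke`) and `W ≤ J₃ − J₂`
give `E_P[ℓ] ≥ hcpE a₀ h₀ − ε + κ·(∫⁻ Dm dP).toReal`; `ε ↓ 0`. [folklore] -/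
theorem stub_coreOfGaugedFloor :
    (∀ a₀ h₀ : ℝ, 189 / 200 ≤ a₀ → a₀ ≤ 199 / 200 → 77 / 100 ≤ h₀ → h₀ ≤ 163 / 200 →
      (∀ a h : ℝ, 0 < a → 0 < h → Summit.AtomisticToContinuum.Crystallization.Theorems.PalmUnimodularRigidity.LayeredLawsSelectHcp.hcpE a₀ h₀ ≤ Summit.AtomisticToContinuum.Crystallization.Theorems.PalmUnimodularRigidity.LayeredLawsSelectHcp.hcpE a h) →
      ∀ δ : ℝ, 0 < δ → ∃ κ : ℝ, 0 < κ ∧ ∃ W : ℝ, 0 ≤ W ∧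
        W ≤ barlowCoupling lennardJones a₀ h₀ 3 - barlowCoupling lennardJones a₀ h₀ 2 ∧
        ∀ ε : ℝ, 0 < ε →
          ∃ R M : ℝ, ∃ t : Measure (EuclideanSpace ℝ (Fin 3)) → EuclideanSpace ℝ (Fin 3) → ℝ,
            (Measurable (Function.uncurry t) ∧ (∀ μ y, |t μ y| ≤ M) ∧ ∀ μ y, R < ‖y‖ → t μ y = 0) ∧
            ∀ (μ : Measure (EuclideanSpace ℝ (Fin 3))) (S : Set (EuclideanSpace ℝ (Fin 3))) (s : ℤ → ℤ)
              (Φ : EuclideanSpace ℝ (Fin 3) → EuclideanSpace ℝ (Fin 3)),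
              μ = (Measure.count : Measure (EuclideanSpace ℝ (Fin 3))).restrict S →
              (0 : EuclideanSpace ℝ (Fin 3)) ∈ S → (∀ x ∈ S, ∀ y ∈ S, x ≠ y → δ ≤ dist x y) →
              (∀ y ∈ S, SetGood S y) → IsHaggSeq s →
              Set.BijOn Φ (barlowStacking 1 (Real.sqrt (2 / 3)) s) S →
              (∀ p ∈ barlowStacking 1 (Real.sqrt (2 / 3)) s, ∀ q ∈ barlowStacking 1 (Real.sqrt (2 / 3)) s,
                (dist p q = 1 ↔ (0 < dist (Φ p) (Φ q) ∧ dist (Φ p) (Φ q) < 6 / 5))) →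
              (∀ p ∈ S, HasSum (fun q : {q : EuclideanSpace ℝ (Fin 3) // q ∈ S ∧ q ≠ p} =>
                (deriv lennardJones (dist p q.1) / dist p q.1) • (p - q.1)) 0) →
              ∀ k i j : ℤ, Φ (barlowPos 1 (Real.sqrt (2 / 3)) s k i j) = 0 →
                barlowSiteEnergy lennardJones a₀ h₀ s k - ε -
                      {S' : Set (EuclideanSpace ℝ (Fin 3)) | FunnelSites.IsCubicSite65 S' 0}.indicator (fun _ => W) S +
                    κ * (min (Summit.AtomisticToContinuum.Crystallization.Theorems.PalmUnimodularRigidity.LayeredLawsSelectHcp.starDefect a₀ h₀ μ)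
                            (⨅ A : EuclideanSpace ℝ (Fin 3) ≃ₗᵢ[ℝ] EuclideanSpace ℝ (Fin 3),
                              ∑ p ∈ fccKissingPattern, Metric.infDist (A (a₀ • p)) (Summit.AtomisticToContinuum.Crystallization.Theorems.PalmUnimodularRigidity.LayeredLawsSelectHcp.rootStar μ) ^ 2) +
                          (μ {y : EuclideanSpace ℝ (Fin 3) | 11 / 10 < ‖y‖ ∧ ‖y‖ ≤ 5 / 4}).toReal) ≤
                  (∫ y, lennardJones ‖y‖ ∂μ) / 2 + ∫ y, (t μ y - t (Measure.map (fun z => z - y) μ) (-y)) ∂μ) →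
    (∀ a₀ h₀ : ℝ, 189 / 200 ≤ a₀ → a₀ ≤ 199 / 200 → 77 / 100 ≤ h₀ → h₀ ≤ 163 / 200 →
        (∀ a h : ℝ, 0 < a → 0 < h →
          Summit.AtomisticToContinuum.Crystallization.Theorems.PalmUnimodularRigidity.LayeredLawsSelectHcp.hcpE a₀ h₀ ≤
            Summit.AtomisticToContinuum.Crystallization.Theorems.PalmUnimodularRigidity.LayeredLawsSelectHcp.hcpE a h) →
        ∀ δ : ℝ, 0 < δ → ∃ κ : ℝ, 0 < κ ∧
          ∀ Dm : Measure (EuclideanSpace ℝ (Fin 3)) → ℝ≥0∞, Measurable Dm →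
            (∀ μ : Measure (EuclideanSpace ℝ (Fin 3)), IsRootedHardCore δ μ →
              Dm μ = ENNReal.ofReal
                (min (Summit.AtomisticToContinuum.Crystallization.Theorems.PalmUnimodularRigidity.LayeredLawsSelectHcp.starDefect a₀ h₀ μ)
                    (⨅ A : EuclideanSpace ℝ (Fin 3) ≃ₗᵢ[ℝ] EuclideanSpace ℝ (Fin 3),
                      ∑ p ∈ fccKissingPattern, Metric.infDist (A (a₀ • p)) (Summit.AtomisticToContinuum.Crystallization.Theorems.PalmUnimodularRigidity.LayeredLawsSelectHcp.rootStar μ) ^ 2) +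
                  (μ {y : EuclideanSpace ℝ (Fin 3) | 11 / 10 < ‖y‖ ∧ ‖y‖ ≤ 5 / 4}).toReal)) →
            ∀ P : Measure (Measure (EuclideanSpace ℝ (Fin 3))), IsProbabilityMeasure P →
              (∀ᵐ μ ∂P, IsRootedHardCore δ μ) → IsPointStationaryLaw P →
              (∀ᵐ μ ∂P, ∃ S : Set (EuclideanSpace ℝ (Fin 3)),
                μ = (Measure.count : Measure (EuclideanSpace ℝ (Fin 3))).restrict S ∧
                (∀ y ∈ S, SetGood S y) ∧
                ∃ s : ℤ → ℤ, IsHaggSeq s ∧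
                  ∃ Φ : EuclideanSpace ℝ (Fin 3) → EuclideanSpace ℝ (Fin 3),
                    Set.BijOn Φ (barlowStacking 1 (Real.sqrt (2 / 3)) s) S ∧
                    ∀ p ∈ barlowStacking 1 (Real.sqrt (2 / 3)) s, ∀ q ∈ barlowStacking 1 (Real.sqrt (2 / 3)) s,
                      (dist p q = 1 ↔ (0 < dist (Φ p) (Φ q) ∧ dist (Φ p) (Φ q) < 6 / 5))) →
              (∀ᵐ μ ∂P, ∃ S : Set (EuclideanSpace ℝ (Fin 3)),
                μ = (Measure.count : Measure (EuclideanSpace ℝ (Fin 3))).restrict S ∧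
                ∀ p ∈ S, HasSum (fun q : {q : EuclideanSpace ℝ (Fin 3) // q ∈ S ∧ q ≠ p} =>
                  (deriv lennardJones (dist p q.1) / dist p q.1) • (p - q.1)) 0) →
              (∀ M : EuclideanSpace ℝ (Fin 3) →L[ℝ] EuclideanSpace ℝ (Fin 3),
                ∫ μ, (∫ y, deriv lennardJones ‖y‖ / ‖y‖ * inner ℝ y (M y) ∂μ) ∂P = 0) →
              Summit.AtomisticToContinuum.Crystallization.Theorems.PalmUnimodularRigidity.LayeredLawsSelectHcp.hcpE a₀ h₀ +
                  κ * (∫⁻ μ, Dm μ ∂P).toReal ≤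
                ∫ μ, (∫ y, lennardJones ‖y‖ ∂μ) / 2 ∂P) := by
  classical
  intro hS4 a₀ h₀ ha₁ ha₂ hh₁ hh₂ hmin δ hδ
  -- item 3063's box from the certified enclosure, and the Lennard-Jones site-energy column AT `(a₀, h₀)`
  obtain ⟨hb1, hb2, hr₁, hr₂⟩ := box3063_of_isMin a₀ h₀ ha₁ ha₂ hh₁ hh₂ hmin
  obtain ⟨hgap, hcol⟩ := SiteColumnLJ.stub_siteColumnLJ a₀ h₀ hb1 hb2 hr₁ hr₂
  set Jd : ℝ := barlowCoupling lennardJones a₀ h₀ 3 - barlowCoupling lennardJones a₀ h₀ 2 with hJd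
  -- S4″ at `(a₀, h₀)` and `δ`
  obtain ⟨κ, hκ, W, hW0, hWJ, hS4ε⟩ := hS4 a₀ h₀ ha₁ ha₂ hh₁ hh₂ hmin δ hδ
  refine ⟨κ, hκ, fun Dm hDm_m hDm P hP hcore hstat hchart hFB _hZS => ?_⟩
  -- the measurable root-covariant cubic mark and the annulus packing bound
  obtain ⟨C, hCm, hCcov, hCiff⟩ := CubicMarkVersion.stub_cubicMarkVersion δ hδ
  obtain ⟨N, hN⟩ := AnnulusCount.stub_annulusCount δ hδ
  -- abbreviations
  set level : ℝ :=
    Summit.AtomisticToContinuum.Crystallization.Theorems.PalmUnimodularRigidity.LayeredLawsSelectHcp.hcpE a₀ h₀ with hlevel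
  set shellInd : EuclideanSpace ℝ (Fin 3) → ℝ≥0∞ :=
    ({z : EuclideanSpace ℝ (Fin 3) | 0 < ‖z‖ ∧ ‖z‖ < 6 / 5}).indicator (fun _ => (1 : ℝ≥0∞)) with hshellInd
  set C0 : Set (Measure (EuclideanSpace ℝ (Fin 3))) :=
    {μ' : Measure (EuclideanSpace ℝ (Fin 3)) | (μ', (0 : EuclideanSpace ℝ (Fin 3))) ∈ C} with hC0
  set nC : Measure (EuclideanSpace ℝ (Fin 3)) → ℝ≥0∞ :=
    fun μ => ∫⁻ y, C.indicator (fun p => shellInd p.2) (μ, y) ∂μ with hnC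
  set Dr : Measure (EuclideanSpace ℝ (Fin 3)) → ℝ := fun μ => (Dm μ).toReal with hDr
  set Bf : ℝ := ∑ p ∈ fccKissingPattern, (‖a₀ • p‖ + 11 / 10) ^ 2 with hBf
  -- measurability facts
  have hshellS : MeasurableSet ({z : EuclideanSpace ℝ (Fin 3) | 0 < ‖z‖ ∧ ‖z‖ < 6 / 5}) :=
    (measurableSet_lt measurable_const measurable_norm).inter (measurableSet_lt measurable_norm measurable_const)
  have hshellm : Measurable shellInd := measurable_one.indicator hshellS
  have hshelleven : ∀ y, shellInd (-y) = shellInd y := fun y => by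
    rw [hshellInd]; exact RouteBetaLawFree.shellIndicator_neg y
  have hC0m : MeasurableSet C0 := measurable_prodMk_right hCm
  have hkn : Measurable (Function.uncurry fun (μ : Measure (EuclideanSpace ℝ (Fin 3))) (y : EuclideanSpace ℝ (Fin 3)) =>
      C.indicator (fun p => shellInd p.2) (μ, y)) := by
    have : (Function.uncurry fun (μ : Measure (EuclideanSpace ℝ (Fin 3))) (y : EuclideanSpace ℝ (Fin 3)) =>
        C.indicator (fun p => shellInd p.2) (μ, y)) = C.indicator (fun p => shellInd p.2) := by
      funext p; rfl
    rw [this]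
    exact (hshellm.comp measurable_snd).indicator hCm
  obtain ⟨ΦN, hΦNm, hΦN⟩ := MarkMeasurable.stub_markMeasurable δ hδ _ hkn
  -- a.s.: twelve neighbours, hence `nC ≤ 12`
  have h12 : ∀ᵐ μ ∂P, ∫⁻ y, shellInd y ∂μ = 12 := by
    filter_upwards [hcore, hchart] with μ hc hch
    obtain ⟨S, rfl, hgood, -⟩ := hch
    obtain ⟨S₀, h0, -, hμ⟩ := hc
    have h0S : (0 : EuclideanSpace ℝ (Fin 3)) ∈ S := by
      have h1 : (Measure.count : Measure (EuclideanSpace ℝ (Fin 3))).restrict S {0} ≠ 0 := by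
        rw [hμ]; exact (count_restrict_singleton_ne_zero_iff S₀ 0).2 h0
      exact (count_restrict_singleton_ne_zero_iff S 0).1 h1
    rw [lintegral_indicator_const hshellS, one_mul]
    exact TwelveNeighbours.stub_twelveNeighbours S (hgood 0 h0S)
  have hnC_le : ∀ μ : Measure (EuclideanSpace ℝ (Fin 3)), nC μ ≤ ∫⁻ y, shellInd y ∂μ := by
    intro μ
    refine lintegral_mono fun y => ?_
    by_cases hy : (μ, y) ∈ C
    · simp only [Set.indicator_of_mem hy, le_refl]
    · simp only [Set.indicator_of_notMem hy, zero_le]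
  have hnC12 : ∀ᵐ μ ∂P, nC μ ≤ 12 := by
    filter_upwards [h12] with μ hμ
    exact (hnC_le μ).trans hμ.le
  have hnCae : nC =ᵐ[P] ΦN := by
    filter_upwards [hcore] with μ hc
    exact (hΦN μ hc).symm
  have hnCm : AEMeasurable nC P := ⟨ΦN, hΦNm, hnCae⟩
  -- the covariant Mecke computation `E_P[nC] = 12 · P(C0)`
  have hMeckeN : ∫⁻ μ, nC μ ∂P = 12 * P C0 := by
    have h1 := CovariantMecke.stub_covariantMecke P hstat C hCm hCcov shellInd hshellm hshelleven
    rw [show (fun μ => nC μ) = fun μ => ∫⁻ y, C.indicator (fun p => shellInd p.2) (μ, y) ∂μ from rfl] at *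
    rw [h1]
    calc ∫⁻ μ, C0.indicator (fun _ => (1 : ℝ≥0∞)) μ * ∫⁻ y, shellInd y ∂μ ∂P
        = ∫⁻ μ, C0.indicator (fun _ => (12 : ℝ≥0∞)) μ ∂P := by
          refine lintegral_congr_ae ?_
          filter_upwards [h12] with μ hμ
          rw [hμ]
          by_cases hm : μ ∈ C0
          · simp only [Set.indicator_of_mem hm, one_mul]
          · simp only [Set.indicator_of_notMem hm, zero_mul]
      _ = 12 * P C0 := lintegral_indicator_const hC0m 12
  have hnC_int : ∫ μ, (nC μ).toReal ∂P = 12 * (P C0).toReal := by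
    rw [integral_toReal hnCm (hnC12.mono fun μ hμ => lt_of_le_of_lt hμ (by norm_num)), hMeckeN,
      ENNReal.toReal_mul]
    norm_num
  have hnC_integrable : Integrable (fun μ => (nC μ).toReal) P := by
    refine Integrable.mono' (integrable_const (12 : ℝ)) hnCm.ennreal_toReal.aestronglyMeasurable ?_
    filter_upwards [hnC12] with μ hμ
    rw [Real.norm_eq_abs, abs_of_nonneg ENNReal.toReal_nonneg]
    have : (nC μ).toReal ≤ (12 : ℝ≥0∞).toReal := ENNReal.toReal_mono (by norm_num) hμ
    simpa using this
  have hind_integrable : Integrable (C0.indicator fun _ => Jd + W) P := (integrable_const (Jd + W)).indicator hC0m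
  have hind_int : ∫ μ, C0.indicator (fun _ => Jd + W) μ ∂P = (Jd + W) * (P C0).toReal := by
    rw [integral_indicator_const (Jd + W) hC0m, smul_eq_mul, measureReal_def, mul_comm]
  -- the defect version: a.s. bounded, hence integrable, and `E_P[Dr] = (∫⁻ Dm dP).toReal`
  have hDr_le : ∀ᵐ μ ∂P, Dr μ ≤ Bf + N := by
    filter_upwards [hcore] with μ hc
    have hfcc_nonneg : 0 ≤ ⨅ A : (EuclideanSpace ℝ (Fin 3)) ≃ₗᵢ[ℝ] (EuclideanSpace ℝ (Fin 3)),
        ∑ p ∈ fccKissingPattern, Metric.infDist (A (a₀ • p)) (rootStar μ) ^ 2 :=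
      Real.iInf_nonneg fun _ => Finset.sum_nonneg fun _ _ => sq_nonneg _
    have hmin0 := le_min (starDefect_nonneg a₀ h₀ μ) hfcc_nonneg
    have hannR : (μ {y : EuclideanSpace ℝ (Fin 3) | 11 / 10 < ‖y‖ ∧ ‖y‖ ≤ 5 / 4}).toReal ≤ N := by
      have := ENNReal.toReal_mono (ENNReal.natCast_ne_top N) (hN μ hc)
      rwa [ENNReal.toReal_natCast] at this
    have hminB := (min_le_right (starDefect a₀ h₀ μ) _).trans (iInf_fccDefect_le a₀ μ)
    show (Dm μ).toReal ≤ Bf + N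
    rw [hDm μ hc, ENNReal.toReal_ofReal (add_nonneg hmin0 ENNReal.toReal_nonneg)]
    linarith
  have hDr_integrable : Integrable Dr P := by
    refine Integrable.mono' (integrable_const (Bf + N)) hDm_m.ennreal_toReal.aestronglyMeasurable ?_
    filter_upwards [hDr_le] with μ hμ
    rw [Real.norm_eq_abs, abs_of_nonneg ENNReal.toReal_nonneg]
    exact hμ
  have hDr_int : ∫ μ, Dr μ ∂P = (∫⁻ μ, Dm μ ∂P).toReal := by
    refine integral_toReal hDm_m.aemeasurable ?_
    filter_upwards [hcore] with μ hc
    rw [hDm μ hc]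
    exact ENNReal.ofReal_lt_top
  -- for every ε: level − ε + κ·(∫⁻ Dm dP).toReal ≤ E_P[h]
  have hb : ∀ ε : ℝ, 0 < ε → level - ε + κ * (∫⁻ μ, Dm μ ∂P).toReal ≤ ∫ μ, (∫ y, lennardJones ‖y‖ ∂μ) / 2 ∂P := by
    intro ε hε
    obtain ⟨R, M, t, ht, hpt⟩ := hS4ε ε hε
    set ℓ : Measure (EuclideanSpace ℝ (Fin 3)) → ℝ := fun μ =>
      level - ε + Jd / 6 * (nC μ).toReal - C0.indicator (fun _ => Jd + W) μ + κ * Dr μ with hℓ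
    have hA : Integrable (fun μ => level - ε + Jd / 6 * (nC μ).toReal - C0.indicator (fun _ => Jd + W) μ) P :=
      ((integrable_const _).add (hnC_integrable.const_mul (Jd / 6))).sub hind_integrable
    have hℓi : Integrable ℓ P := hA.add (hDr_integrable.const_mul κ)
    have hae : ∀ᵐ μ ∂P,
        (ℓ μ ≤ (∫ y, lennardJones ‖y‖ ∂μ) / 2 + ∫ y, (t μ y - t (Measure.map (fun z => z - y) μ) (-y)) ∂μ) ∧
        (¬ True → ℓ μ + 0 ≤ (∫ y, lennardJones ‖y‖ ∂μ) / 2 +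
            ∫ y, (t μ y - t (Measure.map (fun z => z - y) μ) (-y)) ∂μ) := by
      filter_upwards [hcore, hchart, hFB] with μ hc hch hfb
      refine ⟨?_, fun h => absurd trivial h⟩
      obtain ⟨S, hμS, hgood, s, hs, Φ, hbij, hiso⟩ := hch
      -- the carrier sets of the three descriptions of `μ` coincide
      have hmem : ∀ y : (EuclideanSpace ℝ (Fin 3)), y ∈ S ↔ μ {y} ≠ 0 := fun y => by
        rw [hμS]; exact (count_restrict_singleton_ne_zero_iff S y).symm
      obtain ⟨S₀, h0, hsep, hμ0⟩ := hc
      have hmem0 : ∀ y : (EuclideanSpace ℝ (Fin 3)), y ∈ S₀ ↔ μ {y} ≠ 0 := fun y => by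
        rw [hμ0]; exact (count_restrict_singleton_ne_zero_iff S₀ y).symm
      have hS₀ : S₀ = S := Set.ext fun y => (hmem0 y).trans (hmem y).symm
      subst hS₀
      obtain ⟨S', hμS', hFB'⟩ := hfb
      have hmem' : ∀ y : (EuclideanSpace ℝ (Fin 3)), y ∈ S' ↔ μ {y} ≠ 0 := fun y => by
        rw [hμS']; exact (count_restrict_singleton_ne_zero_iff S' y).symm
      have hS' : S' = S₀ := Set.ext fun y => (hmem' y).trans (hmem0 y).symm
      subst hS'
      -- the root is a lattice site of the chart; S4″ at the root
      obtain ⟨p0, hp0, hΦ0⟩ := hbij.surjOn h0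
      obtain ⟨k, i, j, rfl⟩ := hp0
      have key := hpt μ S' s Φ hμS h0 hsep hgood hs hbij hiso hFB' k i j hΦ0
      -- the three letters around the root layer
      set c0 : ℝ := if s k = s (k - 1) then 1 else 0 with hc0
      set cp : ℝ := if s (k + 1) = s k then 1 else 0 with hcp
      set cm : ℝ := if s (k - 1) = s (k - 2) then 1 else 0 with hcm
      -- `pts μ = S` and the mark on `μ`
      have hpts : pts μ = S' :=
        Set.ext fun y => show μ {y} ≠ 0 ↔ y ∈ S' from (hmem y).symm
      have hCμ : ∀ y : (EuclideanSpace ℝ (Fin 3)), (μ, y) ∈ C ↔ FunnelSites.IsCubicSite65 S' y := fun y => by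
        rw [hCiff μ ⟨S', h0, hsep, hμS⟩ y, hpts]
      -- (1) the number of marked `6/5`-neighbours = the number of cubic bonded neighbours of the root
      set B : Set (EuclideanSpace ℝ (Fin 3)) :=
        {y : (EuclideanSpace ℝ (Fin 3)) | FunnelSites.Bond65 S' 0 y ∧ FunnelSites.IsCubicSite65 S' y} with hB
      obtain ⟨hBfin, hBcard⟩ := RootCubicCount.stub_rootCubicCount s S' Φ hs hbij hiso k i j
      rw [hΦ0] at hBfin hBcard
      have hBm : MeasurableSet B := hBfin.measurableSet
      have hBS : B ⊆ S' := fun y hy => hy.1.2.1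
      have hind : ∀ y : (EuclideanSpace ℝ (Fin 3)),
          C.indicator (fun p : Measure (EuclideanSpace ℝ (Fin 3)) × (EuclideanSpace ℝ (Fin 3)) => shellInd p.2) (μ, y) =
            B.indicator (fun _ => (1 : ℝ≥0∞)) y := by
        intro y
        by_cases hyC : (μ, y) ∈ C
        · have hcub : FunnelSites.IsCubicSite65 S' y := (hCμ y).1 hyC
          have hyS : y ∈ S' := hcub.1
          rw [Set.indicator_of_mem hyC]
          by_cases hsh : y ∈ ({z : (EuclideanSpace ℝ (Fin 3)) | 0 < ‖z‖ ∧ ‖z‖ < 6 / 5})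
          · have hyB : y ∈ B := by
              refine ⟨⟨h0, hyS, ?_, ?_⟩, hcub⟩
              · rw [dist_comm, dist_zero_right]; exact hsh.1
              · rw [dist_comm, dist_zero_right]; exact hsh.2
            simp only [hshellInd, Set.indicator_of_mem hsh, Set.indicator_of_mem hyB]
          · have hyB : y ∉ B := by
              intro hyB
              apply hsh
              obtain ⟨⟨-, -, h1, h2⟩, -⟩ := hyB
              rw [dist_comm, dist_zero_right] at h1 h2
              exact ⟨h1, h2⟩
            simp only [hshellInd, Set.indicator_of_notMem hsh, Set.indicator_of_notMem hyB]
        · have hyB : y ∉ B := fun hyB => hyC ((hCμ y).2 hyB.2)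
          rw [Set.indicator_of_notMem hyC, Set.indicator_of_notMem hyB]
      have hnCμ : (nC μ).toReal = 6 * c0 + 3 * cp + 3 * cm := by
        show (∫⁻ y, C.indicator (fun p : Measure (EuclideanSpace ℝ (Fin 3)) × (EuclideanSpace ℝ (Fin 3)) => shellInd p.2) (μ, y) ∂μ).toReal =
          6 * c0 + 3 * cp + 3 * cm
        simp_rw [hind]
        rw [lintegral_indicator_const hBm, one_mul, hμS, Measure.restrict_apply hBm, Set.inter_eq_left.2 hBS,
          Measure.count_apply_finite B hBfin, ENNReal.toReal_natCast, ← Set.ncard_eq_toFinset_card B hBfin, hBcard]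
        simp only [hc0, hcp, hcm]
        push_cast [Nat.cast_ite]
        ring
      -- (2) the root is marked iff its layer is cubic; the root discount of S4″ is the same letter
      have hcubk : FunnelSites.IsCubicSite65 S' 0 ↔ s k = s (k - 1) := by
        rw [← hΦ0]
        exact FunnelSites.isCubicSite65_chart_iff hs hbij hiso k i j
      have hroot : C0.indicator (fun _ => Jd + W) μ = (Jd + W) * c0 := by
        have hiff : μ ∈ C0 ↔ s k = s (k - 1) := by
          rw [← hcubk]
          exact hCμ 0
        by_cases h1 : s k = s (k - 1)
        · rw [Set.indicator_of_mem (hiff.2 h1), hc0, if_pos h1, mul_one]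
        · rw [Set.indicator_of_notMem (fun hm => h1 (hiff.1 hm)), hc0, if_neg h1, mul_zero]
      have hdisc : {S'' : Set (EuclideanSpace ℝ (Fin 3)) | FunnelSites.IsCubicSite65 S'' 0}.indicator (fun _ => W) S' = W * c0 := by
        by_cases h1 : s k = s (k - 1)
        · have hm : S' ∈ {S'' : Set (EuclideanSpace ℝ (Fin 3)) | FunnelSites.IsCubicSite65 S'' 0} := hcubk.2 h1
          rw [Set.indicator_of_mem hm, hc0, if_pos h1, mul_one]
        · have hm : S' ∉ {S'' : Set (EuclideanSpace ℝ (Fin 3)) | FunnelSites.IsCubicSite65 S'' 0} := fun hm => h1 (hcubk.1 hm)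
          rw [Set.indicator_of_notMem hm, hc0, if_neg h1, mul_zero]
      -- (3) the given version `Dm` IS the defect functional on the rooted hard-core configuration `μ`
      have hDμ := (congrArg ENNReal.toReal (hDm μ ⟨S', h0, hsep, hμS⟩)).trans
        (ENNReal.toReal_ofReal (add_nonneg (le_min (starDefect_nonneg a₀ h₀ μ)
          (Real.iInf_nonneg fun _ => Finset.sum_nonneg fun _ _ => sq_nonneg _)) ENNReal.toReal_nonneg))
      -- (4) the column at the root layer closes the arithmetic
      have hcolk := hcol s hs k
      have hident : Jd / 6 * (6 * c0 + 3 * cp + 3 * cm) - (Jd + W) * c0 = 1 / 2 * Jd * (cp + cm) - W * c0 := by ring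
      show level - ε + Jd / 6 * (nC μ).toReal - C0.indicator (fun _ => Jd + W) μ + κ * (Dm μ).toReal ≤ _
      rw [hnCμ, hroot, hDμ]
      rw [hdisc] at key
      linarith [key, hcolk, hident]
    have hprice := LevelPricing.stub_levelPricing δ hδ P hP hcore hstat R M t ht (fun _ => True) ℓ hℓi 0 le_rfl hae
    rw [zero_mul, add_zero] at hprice
    -- `E_P[ℓ] = level − ε + (Jd − W)·P(C0) + κ·(∫⁻ Dm dP).toReal ≥ level − ε + κ·(∫⁻ Dm dP).toReal`
    have hBi : Integrable (fun μ => level - ε + Jd / 6 * (nC μ).toReal) P :=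
      (integrable_const _).add (hnC_integrable.const_mul (Jd / 6))
    have e0 : ∫ μ, ℓ μ ∂P = (∫ μ, (level - ε + Jd / 6 * (nC μ).toReal - C0.indicator (fun _ => Jd + W) μ) ∂P) +
        ∫ μ, κ * Dr μ ∂P := integral_add hA (hDr_integrable.const_mul κ)
    have e1 : ∫ μ, (level - ε + Jd / 6 * (nC μ).toReal - C0.indicator (fun _ => Jd + W) μ) ∂P =
        (∫ μ, (level - ε + Jd / 6 * (nC μ).toReal) ∂P) - ∫ μ, C0.indicator (fun _ => Jd + W) μ ∂P :=
      integral_sub hBi hind_integrable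
    have e3 : ∫ μ, (level - ε + Jd / 6 * (nC μ).toReal) ∂P = (∫ _μ, (level - ε) ∂P) + ∫ μ, Jd / 6 * (nC μ).toReal ∂P :=
      integral_add (integrable_const _) (hnC_integrable.const_mul (Jd / 6))
    have e4 : ∫ _μ, (level - ε) ∂P = level - ε := by rw [integral_const, probReal_univ, one_smul]
    have e5 : ∫ μ, Jd / 6 * (nC μ).toReal ∂P = Jd / 6 * (12 * (P C0).toReal) := by
      rw [integral_const_mul, hnC_int]
    have e6 : ∫ μ, κ * Dr μ ∂P = κ * (∫⁻ μ, Dm μ ∂P).toReal := by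
      rw [integral_const_mul, hDr_int]
    have hP0 : 0 ≤ (P C0).toReal := ENNReal.toReal_nonneg
    have hkey : Jd / 6 * (12 * (P C0).toReal) - (Jd + W) * (P C0).toReal = (Jd - W) * (P C0).toReal := by ring
    have hkey0 : 0 ≤ (Jd - W) * (P C0).toReal := mul_nonneg (by linarith) hP0
    have hℓge : level - ε + κ * (∫⁻ μ, Dm μ ∂P).toReal ≤ ∫ μ, ℓ μ ∂P := by
      rw [e0, e1, e3, e4, e5, e6, hind_int]
      linarith [hkey, hkey0]
    linarith
  -- let ε → 0
  refine le_of_forall_pos_lt_add fun ε hε => ?_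
  have := hb (ε / 2) (by positivity)
  linarith

end Summit.AtomisticToContinuum.Crystallization.Theorems.PalmGoodLaw.CoreOfGaugedFloor

end
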